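import Mathlib
import HarnessLib
import Summits.HubbardSuperconductivity.HubbardSuperconductivity.Theorems.KLProgrammeKLRegimeEnginePairTransferDLineEdgeSplit3

/-!
# Route `KLProgramme` — ENGINE item stmt-HubbardSuperconductivity-20437 `KLRegimeEngineV17F2`, located-risk #9 «ZS-L1» consumer side: the THREE-WAY SPLIT rows of the
# pinned pair IN THE DOOR's NORMALISATION `(Λₙ−Λₙ₊₁)·((βL²)³)⁻¹·‖S‖` — two ROOM rows (constant part, Lipschitz part), one flatness numeral, one WINDOW numeral
# (cell gate-hubbard-kl, seat hubbard-kl-k3c2-p2 g21)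

WHY.  `dLine_pinned_direct/crossed_signed_le_split3` (…DLineEdgeSplit3) bound the literal pinned-pair `D`-rows under `V⊗V = c + F₁ + F₂`.  The (X).3/(c) budget rows
(k3c1's «88b» re-run, KLTC-INDEX §E) read such rows in the door's normalisation `(Λₙ−Λₙ₊₁)((βL²)³)⁻¹·‖S‖`, where the ROOM rows `2(Λₙ−Λₙ₊₁)·Row_{n+2}(A₀, L_A; δ)` are
turned into the engine's monomials by `pinned_row_le_slots(_shift)` (…DLineEdgeForward), the flatness remainder by `pinned_flat_le` (`ε·512·15367`) and — new — the window
part by `window_flat_le` (…PairTransferPHWindowRow: `A₂·1024·15381·(ρ/π + 1/L)`, with `ρ = c_w·Λₙ₊₁` a DECAYING cubic plus a `1/L` entry).  This file does that division once: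
* **`dLine_pinned_direct_split3_door`** — `(Λₙ−Λₙ₊₁)((βL²)³)⁻¹·‖S_D‖ ≤ 2(Λₙ−Λₙ₊₁)Row_{n+2}(2‖c‖, 0; G r) + 2(Λₙ−Λₙ₊₁)Row_{n+2}(A₁, L₁; G r) + ε₁·(512·15367)
  + A₂·(1024·15381)·(ρ/π + 1/L)`, `G = 4 + (8/3)Gfr₁U²`, `r = |p_{x−y}|_𝕋`;
* **`dLine_pinned_crossed_split3_door`** — the crossed twin: `… ≤ (Λₙ−Λₙ₊₁)(Row_{n+2}(‖c‖,0; |−2π/β| + G r̃) + Row_{n+2}(‖c‖,0; |2π/β| + G r̃)) + (same with (A₁,L₁))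
  + ε₁·(512·15367) + A₂·(1024·15381)·(ρ/π + 1/L)`, `r̃ = |p_{Q_m−x−y}|_𝕋`.
Pure real arithmetic over the landed rows; the split data are binders (class #1's export «(E4)-DRESSED-SPLIT»); nothing asserts (X).3, (c), K3 or superconductivity.  0 kit · 0 lit.
-/

noncomputable section

namespace Summit.HubbardSuperconductivity.HubbardSuperconductivity.Theorems.KLRegimeSplit

set_option linter.dupNamespace false -- summit = problem name (single-conjunct summit), D-0017

open Real Set Finset Complex Literature.MathematicalPhysics.QuantumLattice
open Literature.Probability.LatticeModels hiding torusSupNorm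
open Literature.MathematicalPhysics.QuantumLattice.BandSectorCounting
open Summit.HubbardSuperconductivity.HubbardSuperconductivity.Theorems.KLProgrammeLegKernels
open Summit.HubbardSuperconductivity.HubbardSuperconductivity.Theorems.KLRegimeWick
open Summit.HubbardSuperconductivity.HubbardSuperconductivity.Theorems.TwoPointAssembly
open Summit.HubbardSuperconductivity.HubbardSuperconductivity.Theorems.DispersionFlow
open Summit.HubbardSuperconductivity.HubbardSuperconductivity.Theorems.PerturbedFermiCurve

variable {L M : ℕ} [NeZero L] [NeZero M] (β μ : ℝ) (K : TrigPolyC4v)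

/-- **Door arithmetic of a three-way split row**: from `S ≤ b²(b·Rc + b·Rc′) + (b²(b·R₁ + b·R₁′) + E) + W`, `b ≠ 0`, `0 ≤ D·(b³)⁻¹` and the two numeral
readings `D(b³)⁻¹E ≤ e₁`, `D(b³)⁻¹W ≤ e₂`:  `D(b³)⁻¹·S ≤ (D·Rc + D·Rc′) + (D·R₁ + D·R₁′) + e₁ + e₂`. -/
theorem door_split3_arith {D b Rc Rc' R₁ R₁' E W S e₁ e₂ : ℝ} (hb : b ≠ 0)
    (h : S ≤ b ^ 2 * (b * Rc + b * Rc') + (b ^ 2 * (b * R₁ + b * R₁') + E) + W)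
    (hκ : 0 ≤ D * (b ^ 3)⁻¹) (hE : D * (b ^ 3)⁻¹ * E ≤ e₁) (hW : D * (b ^ 3)⁻¹ * W ≤ e₂) :
    D * (b ^ 3)⁻¹ * S ≤ (D * Rc + D * Rc') + (D * R₁ + D * R₁') + e₁ + e₂ := by
  have key : D * (b ^ 3)⁻¹ * (b ^ 2 * (b * Rc + b * Rc') + (b ^ 2 * (b * R₁ + b * R₁') + E) + W) =
      (D * Rc + D * Rc') + (D * R₁ + D * R₁') + D * (b ^ 3)⁻¹ * E + D * (b ^ 3)⁻¹ * W := by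
    field_simp
    ring
  calc D * (b ^ 3)⁻¹ * S ≤ D * (b ^ 3)⁻¹ * (b ^ 2 * (b * Rc + b * Rc') + (b ^ 2 * (b * R₁ + b * R₁') + E) + W) :=
        mul_le_mul_of_nonneg_left h hκ
    _ = (D * Rc + D * Rc') + (D * R₁ + D * R₁') + D * (b ^ 3)⁻¹ * E + D * (b ^ 3)⁻¹ * W := key
    _ ≤ (D * Rc + D * Rc') + (D * R₁ + D * R₁') + e₁ + e₂ := by linarith

section Door

variable {a' b' : ℝ} (B : BandBounds a' b') {R : RenConsts} {U : ℝ} {N : ℕ} {A : ℝ}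

/-- **DIRECT THREE-WAY SPLIT ROW IN THE DOOR's NORMALISATION**: `(Λₙ−Λₙ₊₁)((βL²)³)⁻¹·‖S_D‖ ≤ 2(Λₙ−Λₙ₊₁)Row_{n+2}(2‖c‖,0) + 2(Λₙ−Λₙ₊₁)Row_{n+2}(A₁,L₁) + ε₁·(512·15367) +
A₂·(1024·15381)·(ρ/π + 1/L)` (the two ROOM rows are `pinned_row_le_slots`' input; hypotheses as `dLine_pinned_direct_signed_le_split3`). -/
theorem dLine_pinned_direct_split3_door (hR : ∀ j, 0 ≤ R.Gfr j) (hK : FrameOK R U N μ K)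
    (hAb : ∀ p : Momentum, ∀ j ≤ 2, ‖iteratedFDeriv ℝ j (frameShift K) p‖ ≤ A) (hA : 4 * A < B.Dtmin) (hA20 : 4 * A ≤ 1 / 20) (hμ : μ ≤ -0.15)
    (n : ℕ) {t : ℝ} (ht : t ∈ Icc (0 : ℝ) 1) (hβ : klBetaMin ≤ β) (hβL : β ≤ L) (hn : n + 1 ≤ nScales β + 1)
    (hM : β * (4 * klScale klE0 (n + 1)) / (2 * Real.pi) + 1 ≤ M)
    (Wd : ℝ → FreqMomentum L M → ℝ) (hWd : Wd = fun t k => deriv (fun Λ' : ℝ => hubbardCutoffWeightCT L M β μ K Λ' k) (klScale klE0 n + t * (klScale klE0 (n + 1) - klScale klE0 n)))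
    (V : ℕ → ℝ → (Fin 4 → HubbardFieldIdx L M) → ℂ) {j : ℕ} (hj : n + 2 ≤ j) (Qm x y : TorusSite 2 L)
    (hlo : a' < μ - 4 * klScale klE0 (n + 1) - 4 * A) (hhi : μ + 4 * klScale klE0 (n + 1) + 4 * A < b')
    (hq : (4 + 8 / 3 * R.Gfr 1 * U ^ 2) * klTorusNorm L (x - y) ≤ klScale klE0 (n + 1) / 8)
    (c : ℂ) (F₁ F₂ : FreqMomentum L M → Fin 2 → FreqMomentum L M → ℂ) (F₁₀ : TorusSite 2 L → Fin 2 → TorusSite 2 L → ℂ)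
    (hsplit : ∀ (p : FreqMomentum L M) (σ : Fin 2) (p' : FreqMomentum L M),
      V j t ![((p, σ), 1), ((p', σ), 0), (((omega0 M, y), 0), 0), (((omega0 M, x), 0), 1)] *
          V j t ![((p, σ), 0), ((p', σ), 1), ((((omega0 M).rev, Qm - y), 1), 0), ((((omega0 M).rev, Qm - x), 1), 1)] = c + F₁ p σ p' + F₂ p σ p')
    {A₁ L₁ ε₁ : ℝ} (hA1 : 0 ≤ A₁) (hL1 : 0 ≤ L₁) (hε1 : 0 ≤ ε₁)
    (hY0p₁ : ∀ k : TorusSite 2 L, ‖∑ σ : Fin 2, F₁₀ k σ (k + (x - y))‖ ≤ A₁)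
    (hY1p₁ : ∀ k k' : TorusSite 2 L, ‖(∑ σ : Fin 2, F₁₀ k σ (k + (x - y))) - ∑ σ : Fin 2, F₁₀ k' σ (k' + (x - y))‖ ≤ L₁ * klTorusNorm L (k - k'))
    (hY0m₁ : ∀ k : TorusSite 2 L, ‖∑ σ : Fin 2, F₁₀ (k + -(x - y)) σ k‖ ≤ A₁)
    (hY1m₁ : ∀ k k' : TorusSite 2 L, ‖(∑ σ : Fin 2, F₁₀ (k + -(x - y)) σ k) - ∑ σ : Fin 2, F₁₀ (k' + -(x - y)) σ k'‖ ≤ L₁ * klTorusNorm L (k - k'))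
    (hflat₁ : ∀ (i : MatsubaraIdx M) (σ : Fin 2) (k k' : TorusSite 2 L), matsubaraFreq β M i ^ 2 ≤ (4 * klScale klE0 (n + 1)) ^ 2 →
      ‖F₁ (i, k) σ (i, k') - F₁₀ k σ k'‖ ≤ ε₁)
    (cen : TorusSite 2 L) {ρ A₂ : ℝ} (hρ : 0 ≤ ρ) (hA2 : 0 ≤ A₂)
    (hF₂ : ∀ (p : FreqMomentum L M) (σ : Fin 2) (p' : FreqMomentum L M), ‖F₂ p σ p'‖ ≤ A₂)
    (hsupp₂ : ∀ (p : FreqMomentum L M) (σ : Fin 2) (p' : FreqMomentum L M), ρ < klTorusNorm L (p.2 - cen) → F₂ p σ p' = 0) :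
    (klScale klE0 n - klScale klE0 (n + 1)) * ((β * (L : ℝ) ^ 2) ^ 3)⁻¹ *
        ‖∑ p : FreqMomentum L M, ∑ σ : Fin 2, ∑ p' : FreqMomentum L M,
          if matsubaraInt M p'.1 + matsubaraInt M (omega0 M) = matsubaraInt M p.1 + matsubaraInt M (omega0 M) ∧ p'.2 = p.2 + x - y then
            ((((((softSymbolCompl L M β μ K (n + 1) j p - softSymbolCompl L M β μ K (n + 1) (n + 1) p) : ℝ) : ℂ) * (((β * (L : ℝ) ^ 2 : ℝ) : ℂ) * propCT L M β μ K p)) *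
                  ((((Wd t p') : ℝ) : ℂ) * (((β * (L : ℝ) ^ 2 : ℝ) : ℂ) * propCT L M β μ K p'))) +
                (((((Wd t p) : ℝ) : ℂ) * (((β * (L : ℝ) ^ 2 : ℝ) : ℂ) * propCT L M β μ K p)) *
                  ((((softSymbolCompl L M β μ K (n + 1) j p' - softSymbolCompl L M β μ K (n + 1) (n + 1) p') : ℝ) : ℂ) * (((β * (L : ℝ) ^ 2 : ℝ) : ℂ) * propCT L M β μ K p')))) *
              (V j t ![((p, σ), 1), ((p', σ), 0), (((omega0 M, y), 0), 0), (((omega0 M, x), 0), 1)] *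
                V j t ![((p, σ), 0), ((p', σ), 1), ((((omega0 M).rev, Qm - y), 1), 0), ((((omega0 M).rev, Qm - x), 1), 1)])
          else 0‖ ≤
      2 * ((klScale klE0 n - klScale klE0 (n + 1)) *
          klmsRowBound B.Dtmin A (4 + 8 / 3 * R.Gfr 1 * U ^ 2) (2 * ‖c‖) 0 β n (n + 2) ((4 + 8 / 3 * R.Gfr 1 * U ^ 2) * klTorusNorm L (x - y)) L) +
        2 * ((klScale klE0 n - klScale klE0 (n + 1)) *
          klmsRowBound B.Dtmin A (4 + 8 / 3 * R.Gfr 1 * U ^ 2) A₁ L₁ β n (n + 2) ((4 + 8 / 3 * R.Gfr 1 * U ^ 2) * klTorusNorm L (x - y)) L) +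
        ε₁ * (512 * 15367) + A₂ * (1024 * 15381) * (ρ / π + ((L : ℝ))⁻¹) := by
  have hβ0 : 0 < β := lt_of_lt_of_le (by norm_num [klBetaMin]) hβ
  have hL : (0 : ℝ) < L := by exact_mod_cast Nat.pos_of_ne_zero (NeZero.ne L)
  have hBL : β * (L : ℝ) ^ 2 ≠ 0 := by positivity
  have hκ : 0 ≤ (klScale klE0 n - klScale klE0 (n + 1)) * ((β * (L : ℝ) ^ 2) ^ 3)⁻¹ := by
    refine mul_nonneg ?_ (by positivity)
    rw [klth_klScale_succ]; linarith [klth_klScale_pos n]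
  have h := dLine_pinned_direct_signed_le_split3 β μ K B hR hK hAb hA hA20 hμ n ht hβ hβL hn hM Wd hWd V hj Qm x y hlo hhi hq c F₁ F₂ F₁₀ hsplit
    hA1 hL1 hε1 hY0p₁ hY1p₁ hY0m₁ hY1m₁ hflat₁ cen hρ hA2 hF₂ hsupp₂
  have hE := pinned_flat_le (M := M) β μ K hK hβ hβL n ht hε1 (C := 512 / 3) (by norm_num) le_rfl
  have hW := window_flat_le (L := L) β hβ0 n (m := n + 1) le_rfl ht hA2 (C := 512 / 3) le_rfl hρ
  have hmain := door_split3_arith hBL h hκ hE hW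
  linarith [hmain]

/-- **CROSSED THREE-WAY SPLIT ROW IN THE DOOR's NORMALISATION**: `(Λₙ−Λₙ₊₁)((βL²)³)⁻¹·‖S_{D,x}‖ ≤ (Λₙ−Λₙ₊₁)(Row_{n+2}(‖c‖,0; δ₋) + Row_{n+2}(‖c‖,0; δ₊)) +
(Λₙ−Λₙ₊₁)(Row_{n+2}(A₁,L₁; δ₋) + Row_{n+2}(A₁,L₁; δ₊)) + ε₁·(512·15367) + A₂·(1024·15381)·(ρ/π + 1/L)`, `δ∓ = |∓2π/β| + G·|p_{Q_m−x−y}|_𝕋` (the ROOM rows are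
`pinned_row_le_slots_shift`'s input). -/
theorem dLine_pinned_crossed_split3_door (hR : ∀ j, 0 ≤ R.Gfr j) (hK : FrameOK R U N μ K)
    (hAb : ∀ p : Momentum, ∀ j ≤ 2, ‖iteratedFDeriv ℝ j (frameShift K) p‖ ≤ A) (hA : 4 * A < B.Dtmin) (hA20 : 4 * A ≤ 1 / 20) (hμ : μ ≤ -0.15)
    (n : ℕ) {t : ℝ} (ht : t ∈ Icc (0 : ℝ) 1) (hβ : klBetaMin ≤ β) (hβL : β ≤ L) (hn : n + 1 ≤ nScales β + 1) (hβn : 16 * π / β ≤ klScale klE0 (n + 1))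
    (hM : β * (4 * klScale klE0 (n + 1)) / (2 * Real.pi) + 1 ≤ M)
    (Wd : ℝ → FreqMomentum L M → ℝ) (hWd : Wd = fun t k => deriv (fun Λ' : ℝ => hubbardCutoffWeightCT L M β μ K Λ' k) (klScale klE0 n + t * (klScale klE0 (n + 1) - klScale klE0 n)))
    (V : ℕ → ℝ → (Fin 4 → HubbardFieldIdx L M) → ℂ) {j : ℕ} (hj : n + 2 ≤ j) (Qm x y : TorusSite 2 L)
    (hlo : a' < μ - 4 * klScale klE0 (n + 1) - 4 * A) (hhi : μ + 4 * klScale klE0 (n + 1) + 4 * A < b')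
    (hq : (4 + 8 / 3 * R.Gfr 1 * U ^ 2) * klTorusNorm L (Qm - x - y) ≤ klScale klE0 (n + 1) / 16)
    (c : ℂ) (F₁ F₂ : FreqMomentum L M → FreqMomentum L M → ℂ) (F₁₀ : TorusSite 2 L → TorusSite 2 L → ℂ)
    (hsplit : ∀ (p p' : FreqMomentum L M),
      V j t ![((p, 0), 1), ((p', 1), 0), (((omega0 M, y), 0), 0), ((((omega0 M).rev, Qm - x), 1), 1)] *
          V j t ![((p, 0), 0), ((p', 1), 1), ((((omega0 M).rev, Qm - y), 1), 0), (((omega0 M, x), 0), 1)] = c + F₁ p p' + F₂ p p')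
    {A₁ L₁ ε₁ : ℝ} (hA1 : 0 ≤ A₁) (hL1 : 0 ≤ L₁) (hε1 : 0 ≤ ε₁)
    (hY0B₁ : ∀ k : TorusSite 2 L, ‖F₁₀ k (k + (Qm - x - y))‖ ≤ A₁)
    (hY1B₁ : ∀ k k' : TorusSite 2 L, ‖F₁₀ k (k + (Qm - x - y)) - F₁₀ k' (k' + (Qm - x - y))‖ ≤ L₁ * klTorusNorm L (k - k'))
    (hY0A₁ : ∀ k : TorusSite 2 L, ‖F₁₀ (k + -(Qm - x - y)) k‖ ≤ A₁)
    (hY1A₁ : ∀ k k' : TorusSite 2 L, ‖F₁₀ (k + -(Qm - x - y)) k - F₁₀ (k' + -(Qm - x - y)) k'‖ ≤ L₁ * klTorusNorm L (k - k'))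
    (hflat₁ : ∀ (i i' : MatsubaraIdx M) (k k' : TorusSite 2 L), matsubaraInt M i' + 1 = matsubaraInt M i →
      matsubaraFreq β M i ^ 2 ≤ (5 * klScale klE0 (n + 1)) ^ 2 → ‖F₁ (i, k) (i', k') - F₁₀ k k'‖ ≤ ε₁)
    (cen : TorusSite 2 L) {ρ A₂ : ℝ} (hρ : 0 ≤ ρ) (hA2 : 0 ≤ A₂)
    (hF₂ : ∀ (p p' : FreqMomentum L M), ‖F₂ p p'‖ ≤ A₂)
    (hsupp₂ : ∀ (p p' : FreqMomentum L M), ρ < klTorusNorm L (p.2 - cen) → F₂ p p' = 0) :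
    (klScale klE0 n - klScale klE0 (n + 1)) * ((β * (L : ℝ) ^ 2) ^ 3)⁻¹ *
        ‖∑ p : FreqMomentum L M, ∑ p' : FreqMomentum L M,
          if matsubaraInt M p'.1 + matsubaraInt M (omega0 M) + matsubaraInt M (omega0 M) + 1 = matsubaraInt M p.1 ∧ p'.2 = p.2 + Qm - x - y then
            ((((((softSymbolCompl L M β μ K (n + 1) j p - softSymbolCompl L M β μ K (n + 1) (n + 1) p) : ℝ) : ℂ) * (((β * (L : ℝ) ^ 2 : ℝ) : ℂ) * propCT L M β μ K p)) *
                  ((((Wd t p') : ℝ) : ℂ) * (((β * (L : ℝ) ^ 2 : ℝ) : ℂ) * propCT L M β μ K p'))) +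
                (((((Wd t p) : ℝ) : ℂ) * (((β * (L : ℝ) ^ 2 : ℝ) : ℂ) * propCT L M β μ K p)) *
                  ((((softSymbolCompl L M β μ K (n + 1) j p' - softSymbolCompl L M β μ K (n + 1) (n + 1) p') : ℝ) : ℂ) * (((β * (L : ℝ) ^ 2 : ℝ) : ℂ) * propCT L M β μ K p')))) *
              (V j t ![((p, 0), 1), ((p', 1), 0), (((omega0 M, y), 0), 0), ((((omega0 M).rev, Qm - x), 1), 1)] *
                V j t ![((p, 0), 0), ((p', 1), 1), ((((omega0 M).rev, Qm - y), 1), 0), (((omega0 M, x), 0), 1)])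
          else 0‖ ≤
      ((klScale klE0 n - klScale klE0 (n + 1)) *
            klmsRowBound B.Dtmin A (4 + 8 / 3 * R.Gfr 1 * U ^ 2) ‖c‖ 0 β n (n + 2) (|-(2 * π / β)| + (4 + 8 / 3 * R.Gfr 1 * U ^ 2) * klTorusNorm L (Qm - x - y)) L +
          (klScale klE0 n - klScale klE0 (n + 1)) *
            klmsRowBound B.Dtmin A (4 + 8 / 3 * R.Gfr 1 * U ^ 2) ‖c‖ 0 β n (n + 2) (|2 * π / β| + (4 + 8 / 3 * R.Gfr 1 * U ^ 2) * klTorusNorm L (Qm - x - y)) L) +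
        ((klScale klE0 n - klScale klE0 (n + 1)) *
            klmsRowBound B.Dtmin A (4 + 8 / 3 * R.Gfr 1 * U ^ 2) A₁ L₁ β n (n + 2) (|-(2 * π / β)| + (4 + 8 / 3 * R.Gfr 1 * U ^ 2) * klTorusNorm L (Qm - x - y)) L +
          (klScale klE0 n - klScale klE0 (n + 1)) *
            klmsRowBound B.Dtmin A (4 + 8 / 3 * R.Gfr 1 * U ^ 2) A₁ L₁ β n (n + 2) (|2 * π / β| + (4 + 8 / 3 * R.Gfr 1 * U ^ 2) * klTorusNorm L (Qm - x - y)) L) +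
        ε₁ * (512 * 15367) + A₂ * (1024 * 15381) * (ρ / π + ((L : ℝ))⁻¹) := by
  have hβ0 : 0 < β := lt_of_lt_of_le (by norm_num [klBetaMin]) hβ
  have hL : (0 : ℝ) < L := by exact_mod_cast Nat.pos_of_ne_zero (NeZero.ne L)
  have hBL : β * (L : ℝ) ^ 2 ≠ 0 := by positivity
  have hκ : 0 ≤ (klScale klE0 n - klScale klE0 (n + 1)) * ((β * (L : ℝ) ^ 2) ^ 3)⁻¹ := by
    refine mul_nonneg ?_ (by positivity)
    rw [klth_klScale_succ]; linarith [klth_klScale_pos n]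
  have h := dLine_pinned_crossed_signed_le_split3 β μ K B hR hK hAb hA hA20 hμ n ht hβ hβL hn hβn hM Wd hWd V hj Qm x y hlo hhi hq c F₁ F₂ F₁₀ hsplit
    hA1 hL1 hε1 hY0B₁ hY1B₁ hY0A₁ hY1A₁ hflat₁ cen hρ hA2 hF₂ hsupp₂
  have hE := pinned_flat_le (M := M) β μ K hK hβ hβL n ht hε1 (C := 256 / 3) (by norm_num) (by norm_num)
  have hW := window_flat_le (L := L) β hβ0 n (m := n + 1) le_rfl ht hA2 (C := 256 / 3) (by norm_num) hρ
  exact door_split3_arith hBL h hκ hE hW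

end Door

end Summit.HubbardSuperconductivity.HubbardSuperconductivity.Theorems.KLRegimeSplit

end
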